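import Literature.Probability.Independence.HoeffdingDecompositionParts
import Literature.Probability.Independence.HoeffdingDecompositionTransport
import HarnessLib

/-!
# Hoeffding's decomposition — naturality of the parts under coordinate maps

Continuation of `HoeffdingDecompositionParts.lean` / `HoeffdingDecompositionTransport.lean`.  Source: B. Efron, C. Stein, Ann. Statist. 9 (1981)
§2 (the ANOVA decomposition commutes with relabelling the independent variables and is computed inside any sub-family), W. Hoeffding, Ann. Math.
Statist. 19 (1948) §5.  For the product `ι → β` of copies of ONE probability space `(β, μ)` and bounded measurable `f`:
* `esPart_comp_image` — along an INJECTION `e : ι → ι'` of index sets, `(f ∘ (·∘e))^{=e(T)} = f^{=T} ∘ (·∘e)`;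
* `esPart_comp_of_not_subset_range` — and `(f ∘ (·∘e))^{=T'} = 0` when `T'` contains a coordinate outside the range of `e`;
* `esPart_comp_coordwise` — for COORDINATEWISE measure-preserving maps `Φ(x)_i = φ_i(x_i)`, `(f ∘ Φ)^{=T} = f^{=T} ∘ Φ`.
No definitions, no instances; standard axioms.
-/

set_option autoImplicit false

noncomputable section

open MeasureTheory Finset Function

namespace Literature.Probability.Independence.Hoeffding

variable {ι : Type*} [Fintype ι] [DecidableEq ι] {β : Type*} [MeasurableSpace β]
variable {μ : Measure β} [IsProbabilityMeasure μ] {f : (ι → β) → ℝ}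

section Injective

variable {ι' : Type*} [Fintype ι'] [DecidableEq ι'] {e : ι → ι'}

/-- **Naturality of the parts under an injection of index sets**: `(f ∘ (·∘e))^{=e(T)} (x') = f^{=T} (x' ∘ e)`. [cite: EfronStein1981, §2] -/
theorem esPart_comp_image (he : Injective e) (hf : Measurable f) {C : ℝ} (hC : ∀ x, |f x| ≤ C) (T : Finset ι) (x' : ι' → β) :
    esPart μ (T.image e) (fun z' : ι' → β => f (z' ∘ e)) x' = esPart μ T f (x' ∘ e) := by
  unfold esPart
  rw [Finset.powerset_image, Finset.sum_image fun R _ R' _ h => Finset.image_injective he h]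
  refine Finset.sum_congr rfl fun R _ => ?_
  rw [Finset.card_image_of_injective _ he, Finset.card_image_of_injective _ he, condAvg_comp_of_injective he hf hC]
  congr 2
  ext i
  simp [he.eq_iff]

omit [Fintype ι] [DecidableEq ι] in
/-- Off the range the pull-back has no parts: if `T'` contains a coordinate not of the form `e i`, then `(f ∘ (·∘e))^{=T'} = 0`.
[cite: EfronStein1981, §2] -/
theorem esPart_comp_of_not_subset_range (hf : Measurable f) {C : ℝ} (hC : ∀ x, |f x| ≤ C) {T' : Finset ι'} {j : ι'}
    (hjT : j ∈ T') (hj : ∀ i, e i ≠ j) :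
    esPart μ T' (fun z' : ι' → β => f (z' ∘ e)) = fun _ => 0 := by
  -- `f ∘ (·∘e)` does not depend on `j`, so it equals its own `E_{j}`; then `E_{j}` kills every part containing `j`
  have hdep : DependsOff {j} (fun z' : ι' → β => f (z' ∘ e)) :=
    dependsOff_comp_of_injective (B := ∅) (fun x y _ => by
      have : x = y := funext fun i => ‹∀ i, i ∉ (∅ : Finset ι) → x i = y i› i (Finset.notMem_empty i)
      rw [this]) fun i hi => absurd (Finset.mem_singleton.1 hi) (hj i)
  have hf' : Measurable fun z' : ι' → β => f (z' ∘ e) := measurable_comp_restrict hf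
  rw [← hdep.condAvg_eq (μ := μ), esPart_condAvg {j} T' hf' (fun z' => hC _)]
  rw [if_neg (fun h => Finset.disjoint_singleton_left.1 h hjT)]

end Injective

/-- **Naturality of the parts under coordinatewise measure-preserving maps** (e.g. simultaneous left/right translations of independent
Haar-distributed coordinates): `(f ∘ Φ)^{=T} = f^{=T} ∘ Φ`. [cite: EfronStein1981, §2] -/
theorem esPart_comp_coordwise {φ : ι → β → β} (hφ : ∀ i, MeasurePreserving (φ i) μ μ) (hf : Measurable f) (T : Finset ι)
    (x : ι → β) : esPart μ T (fun z : ι → β => f (fun i => φ i (z i))) x = esPart μ T f (fun i => φ i (x i)) := by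
  unfold esPart
  refine Finset.sum_congr rfl fun R _ => ?_
  rw [condAvg_comp_coordwise hφ hf]

end Literature.Probability.Independence.Hoeffding
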